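import Literature.AlgebraicGeometry.HodgeTheory.StandardChernCharacterBetti
import Literature.AlgebraicGeometry.HodgeTheory.HodgeTypeConjugation
import HarnessLib

/-!
# Rescaling a Chern character theory: `chᵢ ↦ λⁱ · chᵢ` (`λ ∈ ℚˣ`)

Family `hodge`, layer `Literature/AlgebraicGeometry/HodgeTheory`.  The module docstrings of
`HodgeTheory/ChernCharacterBetti` ("rescaling an instance by `λⁱ` in degree `2i` gives another instance") and of
`HodgeTheory/StandardChernCharacterBetti` ("every inhabitant is the standard Chern character up to
`chᵢ ↦ λⁱ chᵢ`, `λ ∈ ℚˣ` — the residual freedom already recorded in `ChernCharacterBetti`") record, informally,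
that the two HYPOTHESIS STRUCTURES `ChernCharacterBetti` and `StandardChernCharacterBetti` are closed under the
rescaling `chᵢ ↦ λⁱ · chᵢ` by a non-zero rational `λ` (for the standard structure the Hodge realisation
`realizeOneOne` is rescaled by `λ` along with `ch₁`).  This file PROVES it from the fields (`ChernCharacterBetti.rescale`,
`StandardChernCharacterBetti.rescale`, with the unfolding lemmas `rescale_ch`, `rescale_realizeOneOne_apply`) and
draws the consequence consumers need when they quantify `∀ C : StandardChernCharacterBetti`:

* `StandardChernCharacterBetti.eq_zero_of_forall_ch_eq` — if ONE standard theory exists and a FIXED class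
  `x ∈ H²ⁱ(X(ℂ); ℂ)`, `0 < i`, equals `C.chᵢ(E)` for EVERY standard theory `C`, then `x = 0` (compare `C` with its
  `λ = 2` rescaling: `2ⁱ · x = x`).  So a consumer statement of the shape "`∃ θ, ∀ C, C.ch₂(F) = -7·θ²`" with `θ² ≠ 0`
  is inconsistent with `Nonempty StandardChernCharacterBetti`; the scale-covariant shape is
  "`∀ C, ∃ λ ≠ 0, C.ch₂(F) = -7·λ²θ²`" (or `θ := C.ch₁(L)` for a line bundle `L`).
* `ChernCharacterBetti.eq_zero_of_forall_ch_eq` — the same for the plain structure.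

Everything here is elementary linear algebra over the fields of the two structures; no new notion is defined
(`rescale` is an operation on inhabitants of existing hypothesis structures).

References: [Fulton1998] W. Fulton, *Intersection Theory*, 2nd ed., Example 3.2.3 (`ch` is a graded polynomial in
the Chern roots, `chᵢ` homogeneous of degree `i` — the source of the `λⁱ`-homogeneity); [BuchweitzFlenner2003]
§4 (before Def. 4.1) and end of §3 (the normalisation `c₁(𝒪(1)) = -At(𝒪(1))` that a CONSTRUCTION fixes and a
hypothesis structure cannot).
-/

noncomputable section

open CategoryTheory AlgebraicGeometry

namespace Literature.AlgebraicGeometry.HodgeTheory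

open Literature.AlgebraicTopology.SingularHomology

/-- Cup powers scale: `(c • x)ⁱ = cⁱ • xⁱ` (bilinearity of `∪`; private copy of the tree's `cupPowTwo_smul`, kept
here to keep the import cone of this file at `ChernCharacterBetti`). [cite: HatcherAT2002, §3.2] -/
private theorem cupPowTwo_smul_aux {Y : Type} [TopologicalSpace Y] (c : ℂ) (x : singularCohomology ℂ ℂ Y 2)
    (i : ℕ) : cupPowTwo (c • x) i = c ^ i • cupPowTwo x i := by
  induction i with
  | zero => rw [cupPowTwo_zero, cupPowTwo_zero, pow_zero, one_smul]
  | succ i ih =>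
    rw [cupPowTwo_succ, cupPowTwo_succ, ih]
    simp only [map_smul, LinearMap.smul_apply, smul_smul, pow_succ, mul_comm]

namespace ChernCharacterBetti

/-- **Rescaling a Chern character theory.**  For `C : ChernCharacterBetti` and a non-zero rational `t`, the theory
`chᵢ ↦ tⁱ · chᵢ` again satisfies every field of `ChernCharacterBetti`: additivity and functoriality are linear,
the degree-`0` normalisation is untouched (`t⁰ = 1`), the exponential on line bundles is homogeneous
(`(t·c₁)ⁱ/i! = tⁱ·c₁ⁱ/i!`), rationality / algebraicity are stable under rational scalars, and the `ℂ`-span of the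
`ch_p(E)` is unchanged (`t^p ≠ 0`).  This is the residual freedom "rescaling an instance by `λⁱ` in degree `2i`
gives another instance" of the module docstring of `ChernCharacterBetti`, now a construction.
[cite: Fulton1998, Example 3.2.3] -/
def rescale (C : ChernCharacterBetti) (t : ℚ) (ht : t ≠ 0) : ChernCharacterBetti where
  ch X E i := ((t ^ i : ℚ) : ℂ) • C.ch X E i
  ch_congr e i := by rw [C.ch_congr e i]
  ch_shortExact S hS h₁ h₃ i := by rw [C.ch_shortExact S hS h₁ h₃ i, smul_add]
  map_ch f E hE i := by rw [map_smul, C.map_ch f E hE i]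
  ch_free_zero X I _ := by rw [pow_zero, Rat.cast_one, one_smul, C.ch_free_zero]
  ch_free_of_pos X I _ i hi := by rw [C.ch_free_of_pos X I hi, smul_zero]
  ch_of_hasRankLE_one hL i hi := by
    rw [C.ch_of_hasRankLE_one hL hi, cupPowTwo_smul_aux, smul_smul, smul_smul, pow_one, Rat.cast_pow,
      mul_comm ((t : ℂ) ^ i)]
  isRationalClass_ch X E hE i := (C.isRationalClass_ch X E hE i).smul (t ^ i)
  ch_mem_algebraicClasses hX E hE i := Submodule.smul_mem _ _ (C.ch_mem_algebraicClasses hX E hE i)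
  algebraicClasses_le_span_ch hX p := by
    refine (C.algebraicClasses_le_span_ch hX p).trans (Submodule.span_le.2 ?_)
    rintro _ ⟨E, hE, rfl⟩
    have htp : ((t ^ p : ℚ) : ℂ) ≠ 0 := by exact_mod_cast pow_ne_zero p ht
    have h : C.ch _ E p = ((t ^ p : ℚ) : ℂ)⁻¹ • (((t ^ p : ℚ) : ℂ) • C.ch _ E p) := by
      rw [smul_smul, inv_mul_cancel₀ htp, one_smul]
    rw [h]
    exact Submodule.smul_mem _ _ (Submodule.subset_span ⟨E, hE, rfl⟩)

/-- Unfolding: `(C.rescale t).chᵢ(E) = tⁱ · C.chᵢ(E)`. [cite: Fulton1998, Example 3.2.3] -/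
@[simp]
theorem rescale_ch (C : ChernCharacterBetti) (t : ℚ) (ht : t ≠ 0) (X : Motives.SchemeOver ℂ) (E : X.left.Modules)
    (i : ℕ) : (C.rescale t ht).ch X E i = ((t ^ i : ℚ) : ℂ) • C.ch X E i :=
  rfl

/-- **A fixed class that is `chᵢ(E)` in EVERY Chern character theory (`0 < i`) vanishes, as soon as one theory
exists**: compare `C` with `C.rescale 2`, `2ⁱ · x = x`.  (So "`∃ x, ∀ C, C.chᵢ E = x`"-shaped hypotheses with `x ≠ 0`
contradict `Nonempty ChernCharacterBetti`; quantify the scale inside `∀ C`.) [cite: Fulton1998, Example 3.2.3] -/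
theorem eq_zero_of_forall_ch_eq (C₀ : ChernCharacterBetti) {X : Motives.SchemeOver ℂ} (E : X.left.Modules) {i : ℕ}
    (hi : 0 < i) {x : complexBetti X (2 * i)} (h : ∀ C : ChernCharacterBetti, C.ch X E i = x) : x = 0 := by
  have h₁ := h C₀
  have h₂ := h (C₀.rescale 2 two_ne_zero)
  rw [rescale_ch, h₁] at h₂
  -- `h₂ : 2ⁱ • x = x`
  have hne : (((2 : ℚ) ^ i : ℚ) : ℂ) - 1 ≠ 0 := by
    have h2i : (1 : ℚ) < 2 ^ i := one_lt_pow₀ (by norm_num) hi.ne'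
    have : (((2 : ℚ) ^ i : ℚ) : ℂ) ≠ 1 := by exact_mod_cast h2i.ne'
    exact sub_ne_zero.2 this
  have hx : ((((2 : ℚ) ^ i : ℚ) : ℂ) - 1) • x = 0 := by rw [sub_smul, one_smul, h₂, sub_self]
  rw [← inv_smul_smul₀ hne x, hx, smul_zero]

end ChernCharacterBetti

namespace StandardChernCharacterBetti

/-- **Rescaling a STANDARD Chern character theory.**  With `ch` rescaled by `tⁱ` in degree `i`, rescale the Hodge
realisation `H¹(X, Ω¹) → H²(X(ℂ); ℂ)` by `t`: it stays injective (`t ≠ 0`), keeps its image (the classes of type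
`(1,1)` form a `ℂ`-subspace) and still carries `Tr(-At(E))` to `ch₁(E)`.  This is the statement "every inhabitant is
the standard Chern character up to `chᵢ ↦ λⁱ chᵢ`, `λ ∈ ℚˣ`" of the module docstring of `StandardChernCharacterBetti`,
read as closure of the structure under that rescaling.  [cite: BuchweitzFlenner2003, §4 (before Def. 4.1)]
[cite: Fulton1998, Example 3.2.3] -/
def rescale (C : StandardChernCharacterBetti) (t : ℚ) (ht : t ≠ 0) : StandardChernCharacterBetti where
  toChernCharacterBetti := C.toChernCharacterBetti.rescale t ht
  realizeOneOne hX := (DistribSMul.toAddMonoidHom (complexBetti _ (2 * 1)) (t : ℂ)).comp (C.realizeOneOne hX)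
  injective_realizeOneOne hX := by
    intro y y' hyy'
    have h : (t : ℂ) • C.realizeOneOne hX y = (t : ℂ) • C.realizeOneOne hX y' := hyy'
    have ht' : (t : ℂ) ≠ 0 := by exact_mod_cast ht
    exact C.injective_realizeOneOne hX (smul_right_injective _ ht' h)
  isOfHodgeType_realizeOneOne hX y := (C.isOfHodgeType_realizeOneOne hX y).smul (t : ℂ)
  exists_realizeOneOne_eq hX _ hc := by
    obtain ⟨y, hy⟩ := C.exists_realizeOneOne_eq hX (hc.smul ((t : ℂ)⁻¹))
    refine ⟨y, ?_⟩
    have ht' : (t : ℂ) ≠ 0 := by exact_mod_cast ht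
    show (t : ℂ) • C.realizeOneOne hX y = _
    rw [hy, smul_smul, mul_inv_cancel₀ ht', one_smul]
  ch_one_eq_realizeOneOne hX E hE := by
    show (((t ^ 1 : ℚ) : ℚ) : ℂ) • C.ch _ E 1 = (t : ℂ) • C.realizeOneOne hX (atiyahChernCharacterOne hE)
    rw [pow_one, C.ch_one_eq_realizeOneOne hX hE]

/-- Unfolding: `(C.rescale t).chᵢ(E) = tⁱ · C.chᵢ(E)`. [cite: Fulton1998, Example 3.2.3] -/
@[simp]
theorem rescale_ch (C : StandardChernCharacterBetti) (t : ℚ) (ht : t ≠ 0) (X : Motives.SchemeOver ℂ)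
    (E : X.left.Modules) (i : ℕ) : (C.rescale t ht).ch X E i = ((t ^ i : ℚ) : ℂ) • C.ch X E i :=
  rfl

/-- Unfolding: the rescaled realisation is `t ·` the old one. [cite: BuchweitzFlenner2003, §4 (before Def. 4.1)] -/
theorem rescale_realizeOneOne_apply (C : StandardChernCharacterBetti) (t : ℚ) (ht : t ≠ 0) {n : ℕ}
    {X : Motives.SchemeOver ℂ} (hX : Motives.IsSmoothProjective n X) (y : Motives.hodgeCohomologyOne X 1) :
    (C.rescale t ht).realizeOneOne hX y = (t : ℂ) • C.realizeOneOne hX y :=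
  rfl

/-- **A fixed class that is `chᵢ(E)` in EVERY standard Chern character theory (`0 < i`) vanishes, as soon as one
standard theory exists** (compare `C` with `C.rescale 2`).  Consequence for consumers quantifying
`∀ C : StandardChernCharacterBetti`: Betti classes prescribed as values of `C.chᵢ`, `i ≥ 1`, must be allowed to
scale with `C` (`λⁱ`), else the prescription is inconsistent with `Nonempty StandardChernCharacterBetti`.
[cite: Fulton1998, Example 3.2.3] -/
theorem eq_zero_of_forall_ch_eq (C₀ : StandardChernCharacterBetti) {X : Motives.SchemeOver ℂ} (E : X.left.Modules)
    {i : ℕ} (hi : 0 < i) {x : complexBetti X (2 * i)} (h : ∀ C : StandardChernCharacterBetti, C.ch X E i = x) :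
    x = 0 := by
  have h₁ := h C₀
  have h₂ := h (C₀.rescale 2 two_ne_zero)
  rw [rescale_ch, h₁] at h₂
  have hne : (((2 : ℚ) ^ i : ℚ) : ℂ) - 1 ≠ 0 := by
    have h2i : (1 : ℚ) < 2 ^ i := one_lt_pow₀ (by norm_num) hi.ne'
    have : (((2 : ℚ) ^ i : ℚ) : ℂ) ≠ 1 := by exact_mod_cast h2i.ne'
    exact sub_ne_zero.2 this
  have hx : ((((2 : ℚ) ^ i : ℚ) : ℂ) - 1) • x = 0 := by rw [sub_smul, one_smul, h₂, sub_self]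
  rw [← inv_smul_smul₀ hne x, hx, smul_zero]

/-- The same with the witness theory supplied as `Nonempty` (the shape of a construction-debt stub).
[cite: Fulton1998, Example 3.2.3] -/
theorem eq_zero_of_forall_ch_eq_of_nonempty (hC : Nonempty StandardChernCharacterBetti) {X : Motives.SchemeOver ℂ}
    (E : X.left.Modules) {i : ℕ} (hi : 0 < i) {x : complexBetti X (2 * i)}
    (h : ∀ C : StandardChernCharacterBetti, C.ch X E i = x) : x = 0 :=
  eq_zero_of_forall_ch_eq hC.some E hi h

end StandardChernCharacterBetti

end Literature.AlgebraicGeometry.HodgeTheory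

end
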